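import Summits.QuantumFields.BalabanUV.Beta.EriceRemainderEnclosureHistoryAutonomyComparisonMarkovCreditLinks

/-!
# EriceRemainderEnclosureHistoryAutonomyComparisonMarkovCredit — (E139b) **COMPARISON WITH MARKOV CREDIT: a memory that is steep in its history where the orbit passes
# still compares with every bounded isotone excess if it is ALSO steep in the CURRENT coupling there — row by row, the graded level profile `Λ_k(A)` of the ages
# `k ≥ 1` is tested against the Markov lower slope `μ` through `Σ_{k<K} Λ_k(A)·Σ_{j=1}^{k} (1+μ)^{−j} ≤ 1` (`le_of_isotone_excess_markov_credit`); with `μ ≡ 0` this is the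
# ROW-WISE GRADED form of (E138): `Σ_k k·Λ_k(A) ≤ 1` at every level `A` the orbit visits and `< 1` deep (`le_of_isotone_excess_graded_moment`).**

THE SETTING ((E132)∕(E138) vocabulary).  `B` isotone on the box `]0,γ]^ℕ` with floor `b > 0` and a zeroth moment (existence ∕ uniqueness of the base family `S q` only);
a LEVEL-GRADED PROFILE: for every level `A`, `B u − B v ≤ Σ_{k<K} Λ_k(A)·(1∕v_k² − 1∕u_k²)⁺` for box configurations whose age-`k` levels are `≥ A + (k+1)·b` (the graded box
ABOVE `A` — every pair of configurations compared at a row whose pin has level `A` lies there), `Λ_k(A) ≥ 0`, with `Σ_k k·Λ_k(A) < 1` for all deep `A`; a MARKOV LOWER SLOPE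
`μ ≥ 0`, antitone in the level: `B v + μ(1∕v_0²)·(1∕v_0² − 1∕u_0²) ≤ B u` for box configurations agreeing at the ages `≥ 1` with `v_0 ≤ u_0`; `B′` ANY functional with
`B ≤ B′ ≤ β̄` on the box and ISOTONE excess; `h, h′` box solutions of `B, B′` from one pin `p`.  ROW CONDITION: for every `A ≥ 1∕p²`,
    `Σ_{k<K} Λ_k(A) · Σ_{j<k} d_A^{j+1} ≤ 1`,   `d_A := (1 + μ(A + K·β̄))⁻¹`.
THEN `h′ ≤ h` AT EVERY SCALE.  With `μ ≡ 0` (`d = 1`) the row condition is `Σ_k k·Λ_k(A) ≤ 1`; a positive Markov slope BUYS history steepness: `Σ_{j<k} d^{j+1} =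
(1 − d^k)∕μ < k`, and for `μ → ∞` any profile with `Σ_{k≥1} Λ_k(A) ≲ μ` passes.  SHARP (numerics, g107 `kit/pedestal107.py`; Lean successor item): the hinge of slope `M̃` at
age `L` over a Markov pedestal of slope `s` fails comparison with a constant excess iff `M̃·(1 − (1+s)^{−L})∕s > 1` — equality in the row condition.

THE PROOF (no contraction above the deep rows — a BACKWARD ROW INDUCTION; new relative to (E138)).  (1) DEEP ROWS ((E139a) `deep_steps_nonneg`): at a row `N` with
`Σ_k kΛ_k(1∕h′_N²) < 1` the tail of `h′` lives in the box `]0,h′_N]` whose graded box is the graded box above `1∕h′_N²`, so (E138b)'s contraction gives `X_n ≥ 0` for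
`n ≥ N`.  (2) ROW STEP (`row_step_nonneg`): if `X_n ≥ 0` at every row below `m` then `X_m ≥ 0`.  For suppose `X_m < 0`: the perturbed coupling `h′_{m+1}` exceeds the
base's `(S h′_m)_1`, so `E_m − X_m = B(tail_1 S h′_m) − B(tail_{m+1}h′) ≤ B(w) − B(tail_{m+1}h′)` with `w` the configuration with `h′_{m+1}` at age `0` and the base's older
couplings (isotonicity); `w` and `tail_{m+1}h′` agree at age `0` and lie in the graded box above `A = 1∕h′_m²`, so the profile bounds this by `Σ_{k≥1} Λ_k(A)·gap_k(m)⁺`;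
the window gaps are at most the DAMPED sums `Σ_{1≤l≤k} d^{k−l} X⁺_{m+l}` ((E139a) `gap_le_sum_damped`; the `l = 0` term vanishes with `X_m < 0`); each `X_{m+l}`, `l ≥ 1`, is
`≤ d·E_{m+l} ≤ d·E_m` by the CREDIT ((E139a) `credit_step_le`: comparison holds below row `m`) and the monotonicity of the source; so `E_m − X_m ≤ E_m·Σ_kΛ_k(A)Σ_{j<k}d^{j+1}
≤ E_m` — contradiction.  (3) `X ≥ 0` everywhere is comparison ((E132) `cmp_of_dual_steps_nonneg`).

Cell `pub-balaban`, β-function sub-cell, BINDER row D4 «RemainderConst leaves for Bałaban's split» (`HOME/BINDER-OWNERS.md`; owner lineage `b2b-balaban-beta-an4`;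
this file by co-owner #2 lineage `b2b-balaban-beta-d4-p2`, generation 107), β-FLOW TEAM duty (1), FREEZE (0) honoured (def-free; (E139a) `gap_le_sum_damped` ∕
`credit_step_le` ∕ `exists_deep_row` ∕ `deep_steps_nonneg` ∕ `level_le_pin_add`, (E138b) `flow_source_le`, (E138a) `level_ge_pin_add` ∕ `dual_step_eq_levels`, (E132)
`cmp_of_dual_steps_nonneg`, (E48a) `family_zero` ∕ `family_mem` ∕ `le_pin_of_memFlow` ∕ `memFlow_tail`, (E39) `exists_memFlow_zm`, (E43b) `memFlow_unique_of_monotone_zm`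
BY NAME; nothing restated).  Successor item (α‴) of `HOME/b2b-balaban-beta-d4-p2/g106/README.md` §4; numerics `HOME/b2b-balaban-beta-d4-p2/g107/kit/`.

HONEST FRAMING (page 1, verbatim and binding).  *"Discharging BetaPertH makes Bałaban's UV stability UNCONDITIONAL — a real constructive-QFT result; it is
NOT the continuum limit and NOT the Clay problem."*  THIS FILE DISCHARGES NOTHING OF THE KIND.  Elementary real analysis about ABSTRACT functionals on a box
]0,γ]^ℕ (node U2's `MemFlow` ∕ `SeqBox`) — hypotheses of a census, not facts: whether Bałaban's (1.22) limit functional has such level profiles or Markov slopes is NOT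
PRINTED ([I] p. 298; GAPS G-t4-U2-1∕-2) and NOT asserted.  Row D4 class UNCHANGED (critical-path width 0; instance 0∕1; D4 DISCHARGE NO DATE).  NOT B12 Thm 2, NOT
BetaPertH, NOT continuum YM, NOT Clay.

WHAT IS PROVED ([folklore]; 0 `def`, 0 sorry).  §1 **`row_step_nonneg`**.  §2 **`steps_nonneg_markov_credit`**.  §3 **`le_of_isotone_excess_markov_credit`**.
§4 **`le_of_isotone_excess_graded_moment`**.
-/

noncomputable section
open Finset Set

namespace Summit.QuantumFields.BalabanUV.Beta.EriceRemainderEnclosureHistoryAutonomyComparisonMarkovCredit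

open Literature.MathematicalPhysics.QuantumFieldTheory.Balaban1983to89
open Literature.MathematicalPhysics.QuantumFieldTheory.Balaban1983to89.T4BetaStationary
open Literature.MathematicalPhysics.QuantumFieldTheory.Balaban1983to89.T4BetaFlowWellPosed
open Summit.QuantumFields.BalabanUV.Beta.EriceRemainderEnclosureHistoryAutonomyOrder
  (family_zero family_mem le_pin_of_memFlow memFlow_tail)
open Summit.QuantumFields.BalabanUV.Beta.EriceRemainderEnclosureHistoryAutonomyComparisonDualOrbit (cmp_of_dual_steps_nonneg)
open Summit.QuantumFields.BalabanUV.Beta.EriceRemainderEnclosureHistoryAutonomyComparisonDualContractionLinks (level_ge_pin_add dual_step_eq_levels)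
open Summit.QuantumFields.BalabanUV.Beta.EriceRemainderEnclosureHistoryAutonomyComparisonDualContraction (flow_source_le)
open Summit.QuantumFields.BalabanUV.Beta.EriceRemainderEnclosureHistoryAutonomyComparisonMarkovCreditLinks
  (level_le_pin_add gap_le_sum_damped credit_step_le exists_deep_row deep_steps_nonneg)

variable {B B' : (ℕ → ℝ) → ℝ} {M γ b βb : ℝ} {S : ℝ → ℕ → ℝ} {h h' : ℕ → ℝ} {μ : ℝ → ℝ} {Λ : ℕ → ℝ → ℝ} {K : ℕ}

/-! ## §1 The row step -/

/-- **THE ROW STEP OF THE BACKWARD INDUCTION.**  Base package (isotone, floor `b > 0`, modulus, unique box solutions `S q`), level-graded profile `Λ_k(A)`, Markov lower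
slope `μ` (antitone, `≥ 0`); `B ≤ B′ ≤ β̄` on the box with isotone excess; `h′` a box solution of `B′`.  At a row `m` with level `A = 1∕h′_m²` where the ROW CONDITION
`Σ_{k<K} Λ_k(A)·Σ_{j<k} d^{j+1} ≤ 1`, `d = (1+μ(A + K·β̄))⁻¹`, holds: if the dual steps are non-negative at every row below `m`, then `X_m ≥ 0`.  (Docstring of the file,
step (2).) [folklore] -/
theorem row_step_nonneg (hb : 0 < b) (hμ0 : ∀ A, 0 ≤ μ A) (hμanti : Antitone μ)
    (hmono : ∀ u v : ℕ → ℝ, SeqBox γ u → SeqBox γ v → (∀ i, u i ≤ v i) → B u ≤ B v)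
    (hB : ∀ u u' : ℕ → ℝ, SeqBox γ u → SeqBox γ u' → ∀ D : ℝ, (∀ j, |u j - u' j| ≤ D) → |B u - B u'| ≤ M * D) (hM : 0 ≤ M)
    (hlo : ∀ u, SeqBox γ u → b ≤ B u)
    (hMk : ∀ u v : ℕ → ℝ, SeqBox γ u → SeqBox γ v → (∀ i, u (i + 1) = v (i + 1)) → v 0 ≤ u 0 →
      B v + μ (1 / v 0 ^ 2) * (1 / v 0 ^ 2 - 1 / u 0 ^ 2) ≤ B u)
    (hS : ∀ p, 0 < p → p ≤ γ → SeqBox γ (S p) ∧ MemFlow B p (S p))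
    (huniq : ∀ p, 0 < p → p ≤ γ → ∀ u u' : ℕ → ℝ, SeqBox γ u → SeqBox γ u' → MemFlow B p u → MemFlow B p u' → u = u')
    (hΛ : ∀ k A, 0 ≤ Λ k A)
    (hLip : ∀ A : ℝ, ∀ u v : ℕ → ℝ, SeqBox γ u → SeqBox γ v → (∀ k : ℕ, A + ((k : ℝ) + 1) * b ≤ 1 / u k ^ 2) →
      (∀ k : ℕ, A + ((k : ℝ) + 1) * b ≤ 1 / v k ^ 2) → B u - B v ≤ ∑ k ∈ range K, Λ k A * max (1 / v k ^ 2 - 1 / u k ^ 2) 0)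
    (hexc : ∀ u, SeqBox γ u → B u ≤ B' u) (hbdd : ∀ u, SeqBox γ u → B' u ≤ βb)
    (hDmono : ∀ u v : ℕ → ℝ, SeqBox γ u → SeqBox γ v → (∀ i, u i ≤ v i) → B' u - B u ≤ B' v - B v)
    (hh' : SeqBox γ h') {y : ℝ} (hf' : MemFlow B' y h') (m : ℕ)
    (hrow : ∑ k ∈ range K, Λ k (1 / h' m ^ 2) * ∑ j ∈ range k, ((1 + μ (1 / h' m ^ 2 + (K : ℝ) * βb))⁻¹) ^ (j + 1) ≤ 1)
    (hbelow : ∀ n, m < n → 0 ≤ 1 / h' (n + 1) ^ 2 - 1 / S (h' n) 1 ^ 2) :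
    0 ≤ 1 / h' (m + 1) ^ 2 - 1 / S (h' m) 1 ^ 2 := by
  by_contra hneg0
  have hneg : 1 / h' (m + 1) ^ 2 - 1 / S (h' m) 1 ^ 2 < 0 := lt_of_not_ge hneg0
  -- names
  set A : ℝ := 1 / h' m ^ 2 with hA
  set d : ℝ := (1 + μ (A + (K : ℝ) * βb))⁻¹ with hd
  have hlo' : ∀ u, SeqBox γ u → b ≤ B' u := fun u hu => (hlo u hu).trans (hexc u hu)
  have hbddB : ∀ u, SeqBox γ u → B u ≤ βb := fun u hu => (hexc u hu).trans (hbdd u hu)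
  have hβb : 0 ≤ βb := by linarith [hlo' h' hh', hbdd h' hh']
  have hd0 : 0 ≤ d := inv_nonneg.mpr (by linarith [hμ0 (A + (K : ℝ) * βb)])
  have hd1 : 0 < 1 + μ (A + (K : ℝ) * βb) := by linarith [hμ0 (A + (K : ℝ) * βb)]
  have hgrow : ∀ n, 1 / h' (n + 1) ^ 2 ≤ 1 / h' n ^ 2 + βb := fun n => by
    rw [hf'.2 n]; linarith [hbdd _ (seqBox_shift hh' (n + 1))]
  have hpm := hh' m
  have hSm := hS (h' m) hpm.1 hpm.2
  -- the tail orbit from the pin h′_m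
  have htailbox : SeqBox γ (fun i => h' (m + i)) := fun i => hh' (m + i)
  have htailflow : MemFlow B' (h' m) (fun i => h' (m + i)) := memFlow_tail hf' m
  -- the perturbed coupling exceeds the base's at scale 1
  have hq1 : 0 < h' (m + 1) := (hh' (m + 1)).1
  have hqS : 0 < S (h' m) 1 := (hSm.1 1).1
  have hlt : S (h' m) 1 < h' (m + 1) := by
    by_contra hge0
    have hge : h' (m + 1) ≤ S (h' m) 1 := le_of_not_gt hge0
    have : 1 / h' (m + 1) ^ 2 ≥ 1 / S (h' m) 1 ^ 2 :=
      one_div_le_one_div_of_le (pow_pos hq1 2) (pow_le_pow_left₀ hq1.le hge 2)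
    linarith
  -- the three configurations
  set u : ℕ → ℝ := fun i => S (h' m) (1 + i) with hu
  set v : ℕ → ℝ := fun i => h' (m + 1 + i) with hv
  set w : ℕ → ℝ := fun i => if i = 0 then h' (m + 1) else S (h' m) (1 + i) with hw
  have hubox : SeqBox γ u := fun i => hSm.1 (1 + i)
  have hvbox : SeqBox γ v := fun i => hh' (m + 1 + i)
  have hwbox : SeqBox γ w := by
    intro i
    by_cases hi : i = 0
    · simp only [hw, hi, if_true]; exact hh' (m + 1)
    · simp only [hw, hi, if_false]; exact hSm.1 (1 + i)
  -- E_m − X_m = B u − B v ≤ B w − B v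
  have hBuw : B u ≤ B w := by
    refine hmono _ _ hubox hwbox fun i => ?_
    by_cases hi : i = 0
    · subst hi; simp only [hu, hw, if_true, add_zero]; exact hlt.le
    · simp [hu, hw, hi]
  -- the graded box above A
  have hgw : ∀ k : ℕ, A + ((k : ℝ) + 1) * b ≤ 1 / w k ^ 2 := by
    intro k
    by_cases hk : k = 0
    · subst hk
      simp only [hw, if_true, Nat.cast_zero, zero_add, one_mul]
      rw [hA, hf'.2 m]
      linarith [hlo' _ (seqBox_shift hh' (m + 1))]
    · simp only [hw, hk, if_false]
      have := level_ge_pin_add hlo hSm.1 hSm.2 (1 + k)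
      push_cast at this
      rw [hA]; linarith
  have hgv : ∀ k : ℕ, A + ((k : ℝ) + 1) * b ≤ 1 / v k ^ 2 := by
    intro k
    have := level_ge_pin_add hlo' htailbox htailflow (1 + k)
    push_cast at this
    simp only [hv]
    rw [hA, show m + 1 + k = m + (1 + k) by omega]; linarith
  have hprof := hLip A w v hwbox hvbox hgw hgv
  -- each window gap is at most the damped sum; the l = 0 term vanishes
  have hXm0 : max (1 / h' (m + 0 + 1) ^ 2 - 1 / S (h' (m + 0)) 1 ^ 2) 0 = 0 := by
    rw [add_zero]; exact max_eq_right hneg.le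
  -- the credit below: X_{m+l+1} ≤ d · E_m for l + 2 ≤ K
  have hcredit : ∀ l : ℕ, l + 2 ≤ K →
      max (1 / h' (m + (l + 1) + 1) ^ 2 - 1 / S (h' (m + (l + 1))) 1 ^ 2) 0
        ≤ d * (B' (fun i => h' (m + 1 + i)) - B (fun i => h' (m + 1 + i))) := by
    intro l hl
    have hXn : 0 ≤ 1 / h' (m + (l + 1) + 1) ^ 2 - 1 / S (h' (m + (l + 1))) 1 ^ 2 := hbelow _ (by omega)
    rw [max_eq_left hXn]
    have hc := credit_step_le (B' := B') (μ := μ) hb hmono hB hM hlo hMk hS huniq hh' hf' (m + (l + 1))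
      (fun i => by
        have := hbelow (m + (l + 1) + i) (by omega)
        simpa [Nat.add_assoc] using this)
    -- μ at the level 1∕h′_{m+l+2}² is at least μ(A + Kβ̄)
    have hlev : 1 / h' (m + (l + 1) + 1) ^ 2 ≤ A + (K : ℝ) * βb := by
      have h1 := level_le_pin_add hbdd htailbox htailflow (l + 2)
      push_cast at h1
      rw [show m + (l + 1) + 1 = m + (l + 2) by omega, hA]
      have : ((l : ℝ) + 2) * βb ≤ (K : ℝ) * βb := mul_le_mul_of_nonneg_right (by exact_mod_cast hl) hβb
      linarith
    have hμle : μ (A + (K : ℝ) * βb) ≤ μ (1 / h' (m + (l + 1) + 1) ^ 2) := hμanti hlev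
    have hsrc : B' (fun i => h' (m + (l + 1) + 1 + i)) - B (fun i => h' (m + (l + 1) + 1 + i))
        ≤ B' (fun i => h' (m + 1 + i)) - B (fun i => h' (m + 1 + i)) := flow_source_le hb hlo' hDmono hh' hf' m l
    have hE0 : 0 ≤ B' (fun i => h' (m + (l + 1) + 1 + i)) - B (fun i => h' (m + (l + 1) + 1 + i)) :=
      sub_nonneg.mpr (hexc _ (seqBox_shift hh' _))
    -- (1 + μ(A+Kβ̄))·X ≤ (1 + μ(level))·X ≤ E_{m+l+1} ≤ E_m
    have hkey : (1 + μ (A + (K : ℝ) * βb)) * (1 / h' (m + (l + 1) + 1) ^ 2 - 1 / S (h' (m + (l + 1))) 1 ^ 2)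
        ≤ B' (fun i => h' (m + 1 + i)) - B (fun i => h' (m + 1 + i)) :=
      ((mul_le_mul_of_nonneg_right (by linarith) hXn).trans hc).trans hsrc
    rw [hd, inv_mul_eq_div, le_div_iff₀ hd1, mul_comm]
    exact hkey
  -- bound the damped sums by E_m · Σ_{j<k} d^{j+1}
  have hD : ∀ k ∈ range K, Λ k A * max (1 / v k ^ 2 - 1 / w k ^ 2) 0
      ≤ Λ k A * ((B' (fun i => h' (m + 1 + i)) - B (fun i => h' (m + 1 + i))) * ∑ j ∈ range k, d ^ (j + 1)) := by
    intro k hk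
    have hkK : k < K := mem_range.mp hk
    refine mul_le_mul_of_nonneg_left ?_ (hΛ k A)
    -- the gap is at most the damped sum
    have hgap : max (1 / v k ^ 2 - 1 / w k ^ 2) 0
        ≤ ∑ l ∈ range (k + 1), d ^ (k - l) * max (1 / h' (m + l + 1) ^ 2 - 1 / S (h' (m + l)) 1 ^ 2) 0 := by
      have hsum0 : 0 ≤ ∑ l ∈ range (k + 1), d ^ (k - l) * max (1 / h' (m + l + 1) ^ 2 - 1 / S (h' (m + l)) 1 ^ 2) 0 :=
        sum_nonneg fun l _ => mul_nonneg (pow_nonneg hd0 _) (le_max_right _ _)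
      by_cases hk0 : k = 0
      · subst hk0
        simp only [hv, hw, if_true, add_zero, sub_self, max_self]
        exact hsum0
      · refine max_le ?_ hsum0
        simp only [hv, hw, hk0, if_false]
        have hceil : 1 / h' (m + 1) ^ 2 + (k : ℝ) * βb ≤ A + (K : ℝ) * βb := by
          have h1 := hgrow m
          have : ((k : ℝ) + 1) * βb ≤ (K : ℝ) * βb := mul_le_mul_of_nonneg_right (by exact_mod_cast hkK) hβb
          rw [hA]; linarith
        have := gap_le_sum_damped hb hμ0 hμanti hmono hB hM hlo hbddB hβb hMk hS huniq hh' hgrow k m hceil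
        rw [← hd] at this
        exact this
    refine hgap.trans ?_
    -- split off l = 0 and use the credit on the rest
    rw [sum_range_succ', hXm0, mul_zero, add_zero, mul_sum]
    -- reflect the index on the right: Σ_{j<k} E d^{j+1} = Σ_{l<k} E d^{k-l}
    rw [← sum_range_reflect (fun j => (B' (fun i => h' (m + 1 + i)) - B (fun i => h' (m + 1 + i))) * d ^ (j + 1)) k]
    refine sum_le_sum fun l hl => ?_
    have hlk : l < k := mem_range.mp hl
    rw [show k - 1 - l + 1 = k - l by omega, show k - (l + 1) = k - l - 1 by omega]
    have hdpow : d ^ (k - l) = d ^ (k - l - 1) * d := by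
      rw [← pow_succ, show k - l - 1 + 1 = k - l by omega]
    rw [hdpow]
    have hc := hcredit l (by omega)
    have := mul_le_mul_of_nonneg_left hc (pow_nonneg hd0 (k - l - 1))
    linarith
  -- assemble: E_m − X_m ≤ E_m · ROW ≤ E_m
  have heq := dual_step_eq_levels hS hh' hf' m
  have hE0 : 0 ≤ B' (fun i => h' (m + 1 + i)) - B (fun i => h' (m + 1 + i)) := sub_nonneg.mpr (hexc _ hvbox)
  have htot : B w - B v ≤ (B' (fun i => h' (m + 1 + i)) - B (fun i => h' (m + 1 + i)))
      * ∑ k ∈ range K, Λ k A * ∑ j ∈ range k, d ^ (j + 1) := by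
    refine hprof.trans ((sum_le_sum hD).trans_eq ?_)
    rw [mul_sum]
    exact sum_congr rfl fun k _ => by ring
  have hrow' : ∑ k ∈ range K, Λ k A * ∑ j ∈ range k, d ^ (j + 1) ≤ 1 := by rw [hA, hd]; exact hrow
  have hfin : B w - B v ≤ B' (fun i => h' (m + 1 + i)) - B (fun i => h' (m + 1 + i)) := by
    have := mul_le_mul_of_nonneg_left hrow' hE0
    linarith
  -- E_m − X_m = B u − B v
  have hBv : B (fun i => h' (m + 1 + i)) = B v := rfl
  have hBu : B (fun i => S (h' m) (1 + i)) = B u := rfl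
  linarith [hBuw, hfin, heq]


/-! ## §2 All dual steps are non-negative -/

/-- **ALL DUAL STEPS ARE NON-NEGATIVE** under the row condition at every level `A ≥ 1∕y²` (`y` the pin of `h′`) and a deep age moment below one: the deep rows by
(E139a) `deep_steps_nonneg`, the rows above by the backward induction `row_step_nonneg`. [folklore] -/
theorem steps_nonneg_markov_credit (hb : 0 < b) (hμ0 : ∀ A, 0 ≤ μ A) (hμanti : Antitone μ)
    (hmono : ∀ u v : ℕ → ℝ, SeqBox γ u → SeqBox γ v → (∀ i, u i ≤ v i) → B u ≤ B v)
    (hB : ∀ u u' : ℕ → ℝ, SeqBox γ u → SeqBox γ u' → ∀ D : ℝ, (∀ j, |u j - u' j| ≤ D) → |B u - B u'| ≤ M * D) (hM : 0 ≤ M)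
    (hlo : ∀ u, SeqBox γ u → b ≤ B u)
    (hMk : ∀ u v : ℕ → ℝ, SeqBox γ u → SeqBox γ v → (∀ i, u (i + 1) = v (i + 1)) → v 0 ≤ u 0 →
      B v + μ (1 / v 0 ^ 2) * (1 / v 0 ^ 2 - 1 / u 0 ^ 2) ≤ B u)
    (hS : ∀ p, 0 < p → p ≤ γ → SeqBox γ (S p) ∧ MemFlow B p (S p))
    (huniq : ∀ p, 0 < p → p ≤ γ → ∀ u u' : ℕ → ℝ, SeqBox γ u → SeqBox γ u' → MemFlow B p u → MemFlow B p u' → u = u')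
    (hΛ : ∀ k A, 0 ≤ Λ k A)
    (hLip : ∀ A : ℝ, ∀ u v : ℕ → ℝ, SeqBox γ u → SeqBox γ v → (∀ k : ℕ, A + ((k : ℝ) + 1) * b ≤ 1 / u k ^ 2) →
      (∀ k : ℕ, A + ((k : ℝ) + 1) * b ≤ 1 / v k ^ 2) → B u - B v ≤ ∑ k ∈ range K, Λ k A * max (1 / v k ^ 2 - 1 / u k ^ 2) 0)
    (hdeep : ∃ A₀ : ℝ, ∀ A, A₀ ≤ A → ∑ k ∈ range K, (k : ℝ) * Λ k A < 1)
    (hexc : ∀ u, SeqBox γ u → B u ≤ B' u) (hbdd : ∀ u, SeqBox γ u → B' u ≤ βb)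
    (hDmono : ∀ u v : ℕ → ℝ, SeqBox γ u → SeqBox γ v → (∀ i, u i ≤ v i) → B' u - B u ≤ B' v - B v)
    (hh' : SeqBox γ h') {y : ℝ} (hf' : MemFlow B' y h')
    (hrow : ∀ A : ℝ, 1 / y ^ 2 ≤ A →
      ∑ k ∈ range K, Λ k A * ∑ j ∈ range k, ((1 + μ (A + (K : ℝ) * βb))⁻¹) ^ (j + 1) ≤ 1) :
    ∀ n, 0 ≤ 1 / h' (n + 1) ^ 2 - 1 / S (h' n) 1 ^ 2 := by
  obtain ⟨A₀, hA₀⟩ := hdeep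
  have hlo' : ∀ u, SeqBox γ u → b ≤ B' u := fun u hu => (hlo u hu).trans (hexc u hu)
  obtain ⟨N, hN⟩ := exists_deep_row hb hlo' hh' hf' A₀
  have hdeepN := deep_steps_nonneg hb hmono hB hM hlo hS huniq hΛ hLip hexc hbdd hDmono hh' hf' N (hA₀ _ hN)
  -- backward induction from the deep row N
  have key : ∀ i : ℕ, ∀ n, N - i ≤ n → 0 ≤ 1 / h' (n + 1) ^ 2 - 1 / S (h' n) 1 ^ 2 := by
    intro i
    induction i with
    | zero => intro n hn; exact hdeepN n (by simpa using hn)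
    | succ i ih =>
      intro n hn
      by_cases hni : N - i ≤ n
      · exact ih n hni
      · have hn1 : ∀ n', n < n' → 0 ≤ 1 / h' (n' + 1) ^ 2 - 1 / S (h' n') 1 ^ 2 := fun n' hn' => ih n' (by omega)
        refine row_step_nonneg hb hμ0 hμanti hmono hB hM hlo hMk hS huniq hΛ hLip hexc hbdd hDmono hh' hf' n (hrow _ ?_) hn1
        have hle := le_pin_of_memFlow hb hlo' hh' hf' n
        exact one_div_le_one_div_of_le (pow_pos (hh' n).1 2) (pow_le_pow_left₀ (hh' n).1.le hle 2)
  intro n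
  exact key N n (by omega)

/-! ## §3 The comparison theorem with Markov credit -/

/-- **COMPARISON WITH MARKOV CREDIT.**  `B`: isotone on the box `]0,γ]^ℕ` with a zeroth moment `M` and floor `b > 0`; a LEVEL-GRADED PROFILE `Λ_k(A) ≥ 0` (for every `A`,
`B u − B v ≤ Σ_{k<K} Λ_k(A)·(1∕v_k² − 1∕u_k²)⁺` on the graded box above `A`) with `Σ_k k·Λ_k(A) < 1` for all deep `A`; a MARKOV LOWER SLOPE `μ ≥ 0`, antitone in the level
(`B v + μ(1∕v_0²)·(1∕v_0² − 1∕u_0²) ≤ B u` for box configurations agreeing at the ages `≥ 1`, `v_0 ≤ u_0`).  `B′`: ANY functional with `B ≤ B′ ≤ β̄` on the box and ISOTONE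
excess.  `h, h′`: box solutions of `B, B′` from one pin `p`.  ROW CONDITION at every level `A ≥ 1∕p²`: `Σ_{k<K} Λ_k(A)·Σ_{j<k} d_A^{j+1} ≤ 1`, `d_A = (1+μ(A + K·β̄))⁻¹`.
Then **`h′ ≤ h` at every scale.**  `μ ≡ 0`: the row-wise graded moment condition (§4); `μ > 0`: the history steepness `Λ` is bought by the Markov slope (`Σ_{j<k}d^{j+1} =
(1 − d^k)∕μ`).  SHARP for the hinge over a Markov pedestal (numerics; Lean successor item). [folklore] -/
theorem le_of_isotone_excess_markov_credit {p : ℝ}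
    (hmono : ∀ u v : ℕ → ℝ, SeqBox γ u → SeqBox γ v → (∀ i, u i ≤ v i) → B u ≤ B v)
    (hB : ∀ u u' : ℕ → ℝ, SeqBox γ u → SeqBox γ u' → ∀ D : ℝ, (∀ j, |u j - u' j| ≤ D) → |B u - B u'| ≤ M * D) (hM : 0 ≤ M)
    (hb : 0 < b) (hlo : ∀ u, SeqBox γ u → b ≤ B u)
    (hΛ : ∀ k A, 0 ≤ Λ k A)
    (hLip : ∀ A : ℝ, ∀ u v : ℕ → ℝ, SeqBox γ u → SeqBox γ v → (∀ k : ℕ, A + ((k : ℝ) + 1) * b ≤ 1 / u k ^ 2) →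
      (∀ k : ℕ, A + ((k : ℝ) + 1) * b ≤ 1 / v k ^ 2) → B u - B v ≤ ∑ k ∈ range K, Λ k A * max (1 / v k ^ 2 - 1 / u k ^ 2) 0)
    (hdeep : ∃ A₀ : ℝ, ∀ A, A₀ ≤ A → ∑ k ∈ range K, (k : ℝ) * Λ k A < 1)
    (hμ0 : ∀ A, 0 ≤ μ A) (hμanti : Antitone μ)
    (hMk : ∀ u v : ℕ → ℝ, SeqBox γ u → SeqBox γ v → (∀ i, u (i + 1) = v (i + 1)) → v 0 ≤ u 0 →
      B v + μ (1 / v 0 ^ 2) * (1 / v 0 ^ 2 - 1 / u 0 ^ 2) ≤ B u)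
    (hexc : ∀ u, SeqBox γ u → B u ≤ B' u) (hbdd : ∀ u, SeqBox γ u → B' u ≤ βb)
    (hDmono : ∀ u v : ℕ → ℝ, SeqBox γ u → SeqBox γ v → (∀ i, u i ≤ v i) → B' u - B u ≤ B' v - B v)
    (hp : 0 < p) (hpγ : p ≤ γ)
    (hrow : ∀ A : ℝ, 1 / p ^ 2 ≤ A →
      ∑ k ∈ range K, Λ k A * ∑ j ∈ range k, ((1 + μ (A + (K : ℝ) * βb))⁻¹) ^ (j + 1) ≤ 1)
    (hh : SeqBox γ h) (hf : MemFlow B p h) (hh' : SeqBox γ h') (hf' : MemFlow B' p h') (j : ℕ) :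
    h' j ≤ h j := by
  -- the unique base family
  have hex : ∀ q : ℝ, 0 < q → q ≤ γ → ∃ k : ℕ → ℝ, SeqBox γ k ∧ MemFlow B q k :=
    fun q hq hqγ => Summit.QuantumFields.BalabanUV.Beta.EriceRemainderEnclosureHistoryAutonomyExistence.exists_memFlow_zm hB hM hq hqγ hb hlo
  choose! S hSb hSf using hex
  have hS : ∀ q, 0 < q → q ≤ γ → SeqBox γ (S q) ∧ MemFlow B q (S q) := fun q hq hqγ => ⟨hSb q hq hqγ, hSf q hq hqγ⟩
  have huniq : ∀ q, 0 < q → q ≤ γ → ∀ u u' : ℕ → ℝ, SeqBox γ u → SeqBox γ u' → MemFlow B q u → MemFlow B q u' → u = u' :=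
    fun q hq _ u u' hu hu' hfu hfu' =>
      Summit.QuantumFields.BalabanUV.Beta.EriceRemainderEnclosureHistoryAutonomyMonotoneGeneral.memFlow_unique_of_monotone_zm hmono hB hM hq hb hlo hu hu' hfu hfu'
  have e : h = S p := huniq p hp hpγ _ _ hh (hS p hp hpγ).1 hf (hS p hp hpγ).2
  rw [e]
  refine cmp_of_dual_steps_nonneg (B' := B') hb hB hM hlo hS huniq hp hpγ hh' hf' j (fun i _ => ?_) j le_rfl
  have h0 := steps_nonneg_markov_credit hb hμ0 hμanti hmono hB hM hlo hMk hS huniq hΛ hLip hdeep hexc hbdd hDmono hh' hf' hrow i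
  have heq := dual_step_eq_levels hS hh' hf' i
  linarith

/-! ## §4 The row-wise graded form of (E138): no Markov slope -/

/-- **COMPARISON FOR EVERY ISOTONE EXCESS UNDER THE ROW-WISE GRADED AGE MOMENT** — the case `μ ≡ 0` of `le_of_isotone_excess_markov_credit`: base package, level-graded
profile `Λ_k(A)` with **`Σ_{k<K} k·Λ_k(A) ≤ 1` at every level `A ≥ 1∕p²`** and `< 1` for all deep `A`; `B ≤ B′ ≤ β̄`, isotone excess.  Then `h′ ≤ h` at every scale.  With a
constant profile this is (E138b) `le_of_isotone_excess_moment`; the gain is that the profile is read on the graded box ABOVE THE ORBIT'S OWN LEVEL at every row (steep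
tops whose slope has decayed where the orbit reads them). [folklore] -/
theorem le_of_isotone_excess_graded_moment {p : ℝ}
    (hmono : ∀ u v : ℕ → ℝ, SeqBox γ u → SeqBox γ v → (∀ i, u i ≤ v i) → B u ≤ B v)
    (hB : ∀ u u' : ℕ → ℝ, SeqBox γ u → SeqBox γ u' → ∀ D : ℝ, (∀ j, |u j - u' j| ≤ D) → |B u - B u'| ≤ M * D) (hM : 0 ≤ M)
    (hb : 0 < b) (hlo : ∀ u, SeqBox γ u → b ≤ B u)
    (hΛ : ∀ k A, 0 ≤ Λ k A)
    (hLip : ∀ A : ℝ, ∀ u v : ℕ → ℝ, SeqBox γ u → SeqBox γ v → (∀ k : ℕ, A + ((k : ℝ) + 1) * b ≤ 1 / u k ^ 2) →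
      (∀ k : ℕ, A + ((k : ℝ) + 1) * b ≤ 1 / v k ^ 2) → B u - B v ≤ ∑ k ∈ range K, Λ k A * max (1 / v k ^ 2 - 1 / u k ^ 2) 0)
    (hdeep : ∃ A₀ : ℝ, ∀ A, A₀ ≤ A → ∑ k ∈ range K, (k : ℝ) * Λ k A < 1)
    (hexc : ∀ u, SeqBox γ u → B u ≤ B' u) (hbdd : ∀ u, SeqBox γ u → B' u ≤ βb)
    (hDmono : ∀ u v : ℕ → ℝ, SeqBox γ u → SeqBox γ v → (∀ i, u i ≤ v i) → B' u - B u ≤ B' v - B v)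
    (hp : 0 < p) (hpγ : p ≤ γ)
    (hrow : ∀ A : ℝ, 1 / p ^ 2 ≤ A → ∑ k ∈ range K, (k : ℝ) * Λ k A ≤ 1)
    (hh : SeqBox γ h) (hf : MemFlow B p h) (hh' : SeqBox γ h') (hf' : MemFlow B' p h') (j : ℕ) :
    h' j ≤ h j := by
  refine le_of_isotone_excess_markov_credit (μ := fun _ => 0) hmono hB hM hb hlo hΛ hLip hdeep (fun _ => le_rfl)
    (fun _ _ _ => le_rfl) ?_ hexc hbdd hDmono hp hpγ ?_ hh hf hh' hf' j
  · intro u v hu hv hagree hle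
    have hvu : B v ≤ B u := hmono v u hv hu fun i => by
      cases i with
      | zero => exact hle
      | succ i => exact (hagree i).symm.le
    simpa using hvu
  · intro A hA
    have e : ∀ k : ℕ, ∑ j ∈ range k, ((1 + (0 : ℝ))⁻¹) ^ (j + 1) = (k : ℝ) := fun k => by simp
    simp only [e]
    calc ∑ k ∈ range K, Λ k A * (k : ℝ) = ∑ k ∈ range K, (k : ℝ) * Λ k A := sum_congr rfl fun k _ => mul_comm _ _
      _ ≤ 1 := hrow A hA

end Summit.QuantumFields.BalabanUV.Beta.EriceRemainderEnclosureHistoryAutonomyComparisonMarkovCredit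

end
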